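import Summits.QuantumAdvantage.AdviceFreeQNC0.AffBells22FrameAveragingCommon
import HarnessLib

/-!
# Sketch22 §2c / ROUND-21 §5.7: the frame ⊗ junta rung with a LINEAR common junta set

`ringFrameJuntaLinCommonLt3`: the `|J₀| ≤ δ₀N` (`δ₀ < 1/2`) strengthening of the planner's `RingFrameJuntaCommonLt3`
(`|J₀| ≤ (log₂N)^C`), which ROUND-21 §5.7 identified as necessary ("(G1) LINEAR").  NOT a planner-typed statement: the
hypotheses are those of `RingFrameJuntaCommonLt3` with the polylog bound replaced by `(|J₀| : ℝ) ≤ δ₀·N`, and `θ = θ(δ₀)`.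
Proof = `frameAveragingCommon` (in the error term `J₀` is arbitrary) + `AffBells23.juntaCommonHard2 δ₀` (the frozen strategies
are junta ⊕ common-set strategies).  (The verbatim rung `ringFrameJuntaCommonLt3` is the case `δ₀ = 1/4`, already in `AffBells22FrameAveragingCommon`.)
Separation NOT moved.
-/

namespace Summit.QuantumAdvantage.AdviceFreeQNC0

open Finset Literature.Computability.QuantumComplexity Literature.Computability.QuantumComplexity.RingHLF
open Literature.Computability.MetaComplexity

namespace AffBells22

/-- **RUNG R-frame ⊗ junta with a LINEAR common junta set** (ROUND-21 §5.7 asked for `|J₀| ≤ δ₀N`; NOT a planner-typed statement —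
the `|J₀| ≤ δ₀N`, `δ₀ < 1/2` strengthening of `RingFrameJuntaCommonLt3`, with `θ = θ(δ₀)`): every strategy whose outputs are arbitrary
functions of a frame value (frame of dimension `m ≤ μ₀N`, `δ`-regular OFF `J₀`), of `≤ w₀` own input bits and of a COMMON set `J₀` of
`≤ δ₀N` input bits satisfies the ring relation on at most `θ·2^{N−1}` odd patterns.  Proof: `frameAveragingCommon` (error term: `J₀`
arbitrary) + `AffBells23.juntaCommonHard2 δ₀` (frozen strategies). -/
theorem ringFrameJuntaLinCommonLt3 :
    ∀ δ : ℝ, 0 < δ → ∀ δ₀ : ℝ, δ₀ < 1 / 2 → ∀ w₀ : ℕ, ∃ μ₀ : ℝ, 0 < μ₀ ∧ ∃ θ : ℝ, θ < 1 ∧ ∃ n₀ : ℕ, ∀ N ≥ n₀, ∀ m : ℕ,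
      (m : ℝ) ≤ μ₀ * N →
      ∀ (V : Fin m → Fin N → ZMod 3) (J₀ : Finset (Fin N)) (T : Fin N → Finset (Fin N))
        (τ : Fin N → (Fin m → ZMod 3) → (Fin N → Bool) → Bool),
        ((J₀.card : ℝ) ≤ δ₀ * N) →
        (∀ t : Fin m → ZMod 3, t ≠ 0 →
          δ * N ≤ ((univ.filter fun i : Fin N => i ∉ J₀ ∧ (∑ l : Fin m, t l * V l i) ≠ 0).card : ℝ)) →
        (∀ k, (T k).card ≤ w₀) → (∀ k y, ReadsOnly (T k ∪ J₀) (τ k y)) →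
        (winCount (frameJuntaBell V τ) : ℝ) ≤ θ * (2 : ℝ) ^ (N - 1) := by
  intro δ hδ δ₀ hδ₀ w₀
  obtain ⟨θ₂, hθ₂, hj⟩ := AffBells23.juntaCommonHard2 δ₀ hδ₀
  obtain ⟨n₁, hn₁⟩ := hj w₀
  set ε : ℝ := (1 - θ₂) / 2 with hε
  have hεpos : 0 < ε := by rw [hε]; linarith
  obtain ⟨μ₀, hμ₀, n₂, hn₂⟩ := frameAveragingCommon δ hδ w₀ ε hεpos
  refine ⟨μ₀, hμ₀, θ₂ + ε, by rw [hε]; linarith, max n₁ n₂, fun N hN m hm V J₀ T τ hJ₀ hreg hT hread => ?_⟩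
  have hN₁ : n₁ ≤ N := le_trans (le_max_left _ _) hN
  have hN₂ : n₂ ≤ N := le_trans (le_max_right _ _) hN
  have havg := hn₂ N hN₂ m hm V J₀ T τ hreg hT hread
  have hfrozen : ∀ u : Fin m → ZMod 3, (winCount (frozenBell τ u) : ℝ) ≤ θ₂ * (2 : ℝ) ^ (N - 1) :=
    fun u => hn₁ N hN₁ J₀ T (fun k => τ k u) hJ₀ hT (fun k => hread k u)
  have hsum : (∑ u : Fin m → ZMod 3, (winCount (frozenBell τ u) : ℝ)) / (3 : ℝ) ^ m ≤ θ₂ * (2 : ℝ) ^ (N - 1) := by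
    rw [div_le_iff₀ (by positivity)]
    calc ∑ u : Fin m → ZMod 3, (winCount (frozenBell τ u) : ℝ)
        ≤ ∑ _u : Fin m → ZMod 3, θ₂ * (2 : ℝ) ^ (N - 1) := sum_le_sum fun u _ => hfrozen u
      _ = θ₂ * (2 : ℝ) ^ (N - 1) * (3 : ℝ) ^ m := by
          rw [sum_const, card_univ, card_frame, nsmul_eq_mul]
          push_cast
          ring
  calc (winCount (frameJuntaBell V τ) : ℝ)
      ≤ (∑ u : Fin m → ZMod 3, (winCount (frozenBell τ u) : ℝ)) / (3 : ℝ) ^ m + ε * (2 : ℝ) ^ (N - 1) := havg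
    _ ≤ θ₂ * (2 : ℝ) ^ (N - 1) + ε * (2 : ℝ) ^ (N - 1) := by linarith
    _ = (θ₂ + ε) * (2 : ℝ) ^ (N - 1) := by ring

end AffBells22

end Summit.QuantumAdvantage.AdviceFreeQNC0
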